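import Literature.AlgebraicGeometry.HodgeTheory.BettiUniverseAxioms
import Literature.AlgebraicGeometry.HodgeTheory.HodgeModelExistenceProofs
import Literature.NumberTheory.Transcendental.ComplexFormsPullback
import Literature.NumberTheory.Transcendental.AnalytificationFunctorialityProofs
import Literature.Geometry.Kaehler.ManifoldFormsPullback
import HarnessLib

/-!
# The standard Hodge model of a smooth projective complex variety

Reproduction (Literature): definitions and kernel-checked consequences of tree facts; no new
axioms, every declaration kernel-checked.

For a smooth projective `X/ℂ` of dimension `n`, Serre's analytification `X^an` is a compact
complex manifold with a holomorphic atlas valued in `ℂⁿ` (GAGA §2; the tree's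
`exists_compact_isAnalytification_of_isSmoothProjective`). A `HodgeModel n X`
(`Literature.AlgebraicGeometry.HodgeTheory.HodgeModel`) packages such a manifold together with a
natural complex de Rham comparison family over ALL manifolds charted on its model space and the
Hodge decomposition of `X^an`. The models supplied by the hypothesis
`exists_isReal_hodgeModel` (`BettiUniverse.realHodgeModel`) have an unspecified model space and
an unspecified comparison family, one per variety.

This file builds, from the same hypothesis `hHD : exists_isReal_hodgeModel` and nothing else,
the **standard Hodge model** `stdModel hHD hX : HodgeModel n X`:

* its model space is LITERALLY `Fin n → ℂ` and its carrier is a chosen GAGA analytification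
  `stdCarrier hX` (compact, Hausdorff, holomorphic atlas on `ℂⁿ`);
* its de Rham comparison is the complexification `(stdFamily n) ⊗ ℂ`
  (`DeRhamIsoFamily.complexify`) of ONE chosen real de Rham isomorphism family `stdFamily n` on
  the manifolds charted on `ℂⁿ` which is natural, multiplicative and normalised (de Rham's
  theorem, Warner Thm. 5.36/5.45, the tree's `exists_deRhamIsoFamily_holds`) — the SAME family
  for every `X` of dimension `n`, so that classes of forms on different varieties of the same
  dimension are compared by ONE natural transformation (pull-back along morphisms `X' ⟶ X`,
  cup products);
* its Hodge decomposition is TRANSPORTED from the Hodge model `realHodgeModel hHD hX` along the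
  biholomorphism `X^an_std ≅ X^an_real` over `X(ℂ)` (uniqueness of the analytification, GAGA §2
  fonctorialité: the tree's `IsAnalytification.mdifferentiable_comp_map_holds` applied to `𝟙 X`
  in both directions), using `φ^* H^{p,q}(N) = H^{p,q}(M)` for a biholomorphism `φ` (Voisin I
  §7.3.2, the tree's `hodgePQ_map_eq_of_leftInverse`).

Main declarations: `stdFamily`, `stdFamily_isNatural`, `stdFamily_isMultiplicative`,
`StdCarrier`, `stdCarrier`, `isInternal_hodgePQ_transport` (transport of a Hodge decomposition
along a biholomorphism), `isInternal_hodgePQ_stdCarrier`, `stdModel` (an `abbrev`, so that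
`(stdModel hHD hX).model` reduces to `Fin n → ℂ`), `stdModel_deRham_apply`.

## References

* J.-P. Serre, *Géométrie algébrique et géométrie analytique* (GAGA), Ann. Inst. Fourier 6
  (1956), §2.
* C. Voisin, *Hodge Theory and Complex Algebraic Geometry I* (2002), §4.3.2 Rem. 4.48, §6.1.3
  Prop. 6.11, Thm. 6.18, §7.3.2.
* F. W. Warner, *Foundations of Differentiable Manifolds and Lie Groups* (GTM 94, 1983),
  Thm. 5.36, Thm. 5.45.
-/

noncomputable section

open scoped Manifold ContDiff
open CategoryTheory

namespace Literature.AlgebraicGeometry.HodgeTheory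

open Literature.NumberTheory.Transcendental
open Literature.AlgebraicTopology.SingularHomology (singularCohomology)

/-! ### The standard real de Rham family on the manifolds charted on `ℂⁿ` -/

/-- **The standard de Rham isomorphism family on `ℂⁿ`-charted manifolds**: a choice of a natural,
multiplicative and normalised real de Rham isomorphism family `H^k_dR(M; ℝ) ≅ Hᵏ(M; ℝ)` over all
manifolds charted on `ℂⁿ = ℝ^{2n}` (de Rham's theorem, the tree's proved
`exists_deRhamIsoFamily_holds`). [cite: WarnerGTM94, Thm. 5.36 / Thm. 5.45] -/
def stdFamily (n : ℕ) : DeRhamIsoFamily 𝓘(ℝ, Fin n → ℂ) :=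
  Classical.choose (exists_deRhamIsoFamily_holds (Fin n → ℂ))

/-- The standard family is natural for `C^∞` maps. [cite: WarnerGTM94, Thm. 5.36] -/
theorem stdFamily_isNatural (n : ℕ) : (stdFamily n).IsNatural :=
  (Classical.choose_spec (exists_deRhamIsoFamily_holds (Fin n → ℂ))).1

/-- The standard family is multiplicative (`e[α ∧ β] = e[α] ∪ e[β]`). [cite: WarnerGTM94, Thm. 5.45] -/
theorem stdFamily_isMultiplicative (n : ℕ) : (stdFamily n).IsMultiplicative :=
  (Classical.choose_spec (exists_deRhamIsoFamily_holds (Fin n → ℂ))).2.1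

/-- The standard family is normalised. [cite: WarnerGTM94, Thm. 5.36] -/
theorem stdFamily_isNormalized (n : ℕ) : (stdFamily n).IsNormalized :=
  (Classical.choose_spec (exists_deRhamIsoFamily_holds (Fin n → ℂ))).2.2

/-! ### Standard carriers: GAGA analytifications charted on `ℂⁿ` -/

/-- **A standard analytification of `X`**: a compact Hausdorff complex manifold with a holomorphic
atlas valued in `ℂⁿ`, exhibited as the analytification of `X` (relative dimension `n`) by
`toComplexPoints`. [cite: SerreGAGA1956, §2 n°5 Prop. 2 and n°7 Prop. 6] -/
structure StdCarrier (n : ℕ) (X : Motives.SchemeOver ℂ) : Type 1 where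
  /-- The underlying set of `X^an`. [cite: SerreGAGA1956, §2] -/
  carrier : Type
  /-- The analytic topology. [cite: SerreGAGA1956, §2] -/
  [topologicalSpace : TopologicalSpace carrier]
  /-- `X^an` is Hausdorff. [cite: SGA1, Exp. XII Prop. 3.1] -/
  [t2Space : T2Space carrier]
  /-- `X^an` is compact (`X` proper). [cite: SerreGAGA1956, §2 n°7 Prop. 6] -/
  [compactSpace : CompactSpace carrier]
  /-- The atlas, valued in `ℂⁿ`. [cite: SerreGAGA1956, §2] -/
  [chartedSpace : ChartedSpace (Fin n → ℂ) carrier]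
  /-- The atlas is holomorphic. [cite: SerreGAGA1956, §2] -/
  [isManifold : IsManifold 𝓘(ℂ, Fin n → ℂ) ω carrier]
  /-- The comparison map `X^an → X(ℂ)`. [cite: SerreGAGA1956, §2] -/
  toComplexPoints : carrier → Motives.ComplexPoints X
  /-- `toComplexPoints` is the analytification of `X`. [cite: SerreGAGA1956, §2] -/
  isAnalytification : IsAnalytification (Fin n → ℂ) X n toComplexPoints

namespace StdCarrier

attribute [instance] topologicalSpace t2Space compactSpace chartedSpace isManifold

variable {n : ℕ} {X : Motives.SchemeOver ℂ} (S : StdCarrier n X)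

/-- The real `C^∞` structure underlying the holomorphic atlas. [cite: WellsDACM1980, Ch. I §3] -/
instance isManifold_real : IsManifold 𝓘(ℝ, Fin n → ℂ) ∞ S.carrier :=
  Literature.Geometry.Kaehler.isManifold_real_of_isManifold_complex

/-- `X^an` is σ-compact (it is compact). [cite: SGA1, Exp. XII Prop. 3.2] -/
instance sigmaCompactSpace : SigmaCompactSpace S.carrier := inferInstance

end StdCarrier

/-- **Existence of a standard analytification** of a smooth projective `X/ℂ` of dimension `n`
(the tree's `exists_compact_isAnalytification_of_isSmoothProjective`).
[cite: SerreGAGA1956, §2 n°5 Prop. 2 and n°7 Prop. 6] [cite: SGA1, Exp. XII Thm. 1.1] -/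
theorem nonempty_stdCarrier {n : ℕ} {X : Motives.SchemeOver ℂ} (hX : Motives.IsSmoothProjective n X) :
    Nonempty (StdCarrier n X) := by
  obtain ⟨M, _, _, _, _, _, φ, hφ⟩ := exists_compact_isAnalytification_of_isSmoothProjective hX
  exact ⟨{ carrier := M, toComplexPoints := φ, isAnalytification := hφ }⟩

/-- **The standard analytification** `X^an` of a smooth projective `X/ℂ`: a choice.
[cite: SerreGAGA1956, §2] -/
def stdCarrier {n : ℕ} {X : Motives.SchemeOver ℂ} (hX : Motives.IsSmoothProjective n X) :
    StdCarrier n X :=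
  Classical.choice (nonempty_stdCarrier hX)

/-! ### Transport of a Hodge decomposition along a biholomorphism -/

section Transport

universe u

variable {E E' : Type u} [NormedAddCommGroup E] [NormedSpace ℂ E] [NormedAddCommGroup E']
  [NormedSpace ℂ E'] {M M' : Type u} [TopologicalSpace M] [ChartedSpace E M]
  [IsManifold 𝓘(ℝ, E) ∞ M] [TopologicalSpace M'] [ChartedSpace E' M'] [IsManifold 𝓘(ℝ, E') ∞ M']

/-- **A biholomorphism identifies complex de Rham cohomology**: for real-`C^∞` maps `f : M → M'`,
`g : M' → M` inverse to each other, `f^*` is a linear equivalence `H^k_dR(M'; ℂ) ≃ H^k_dR(M; ℂ)`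
with inverse `g^*` (functoriality `(g ∘ f)^* = f^* ∘ g^*`, `id^* = id`). [cite: BottTu1982Forms, §I.2] -/
def complexDeRhamCohomologyEquivOfInverse [PullbackFacts 𝓘(ℝ, E) M 𝓘(ℝ, E') M' ℂ]
    [PullbackFacts 𝓘(ℝ, E') M' 𝓘(ℝ, E) M ℂ] [PullbackFacts 𝓘(ℝ, E) M 𝓘(ℝ, E) M ℂ]
    [PullbackFacts 𝓘(ℝ, E') M' 𝓘(ℝ, E') M' ℂ] {f : M → M'} {g : M' → M}
    (hf : ContMDiff 𝓘(ℝ, E) 𝓘(ℝ, E') ∞ f) (hg : ContMDiff 𝓘(ℝ, E') 𝓘(ℝ, E) ∞ g)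
    (hgf : Function.LeftInverse g f) (hfg : Function.RightInverse g f) (k : ℕ) :
    complexDeRhamCohomology E' M' k ≃ₗ[ℂ] complexDeRhamCohomology E M k :=
  LinearEquiv.ofLinear (complexDeRhamCohomology.map E hf k) (complexDeRhamCohomology.map E' hg k)
    (by
      rw [← complexDeRhamCohomology.map_comp hg hf,
        complexDeRhamCohomology.map_congr (hg.comp hf) contMDiff_id (funext hgf) k,
        complexDeRhamCohomology.map_id])
    (by
      rw [← complexDeRhamCohomology.map_comp hf hg,
        complexDeRhamCohomology.map_congr (hf.comp hg) contMDiff_id (funext hfg) k,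
        complexDeRhamCohomology.map_id])

/-- The transport equivalence acts as pull-back along `f` on classes. [folklore] -/
@[simp]
theorem complexDeRhamCohomologyEquivOfInverse_apply [PullbackFacts 𝓘(ℝ, E) M 𝓘(ℝ, E') M' ℂ]
    [PullbackFacts 𝓘(ℝ, E') M' 𝓘(ℝ, E) M ℂ] [PullbackFacts 𝓘(ℝ, E) M 𝓘(ℝ, E) M ℂ]
    [PullbackFacts 𝓘(ℝ, E') M' 𝓘(ℝ, E') M' ℂ] {f : M → M'} {g : M' → M}
    (hf : ContMDiff 𝓘(ℝ, E) 𝓘(ℝ, E') ∞ f) (hg : ContMDiff 𝓘(ℝ, E') 𝓘(ℝ, E) ∞ g)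
    (hgf : Function.LeftInverse g f) (hfg : Function.RightInverse g f) (k : ℕ)
    (c : complexDeRhamCohomology E' M' k) :
    complexDeRhamCohomologyEquivOfInverse hf hg hgf hfg k c = complexDeRhamCohomology.map E hf k c :=
  rfl

/-- **Transport of the Hodge decomposition along a biholomorphism** (Voisin I §7.3.2: a
biholomorphism `f` identifies `H^{p,q}(M')` with `H^{p,q}(M)` via `f^*`,
`hodgePQ_map_eq_of_leftInverse`; hence `H^k_dR(M'; ℂ) = ⨁_{p+q=k} H^{p,q}(M')` transports to `M`).
[cite: VoisinHodgeI2002, §7.3.2 and §6.1.3 Prop. 6.11] -/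
theorem isInternal_hodgePQ_transport [T2Space M] [SigmaCompactSpace M] [T2Space M']
    [SigmaCompactSpace M'] [PullbackFacts 𝓘(ℝ, E) M 𝓘(ℝ, E') M' ℂ]
    [PullbackFacts 𝓘(ℝ, E') M' 𝓘(ℝ, E) M ℂ] [PullbackFacts 𝓘(ℝ, E) M 𝓘(ℝ, E) M ℂ]
    [PullbackFacts 𝓘(ℝ, E') M' 𝓘(ℝ, E') M' ℂ] {f : M → M'} {g : M' → M}
    (hf : ContMDiff 𝓘(ℝ, E) 𝓘(ℝ, E') ∞ f) (hf' : MDifferentiable 𝓘(ℂ, E) 𝓘(ℂ, E') f)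
    (hg : ContMDiff 𝓘(ℝ, E') 𝓘(ℝ, E) ∞ g) (hg' : MDifferentiable 𝓘(ℂ, E') 𝓘(ℂ, E) g)
    (hgf : Function.LeftInverse g f) (hfg : Function.RightInverse g f) {k : ℕ}
    (hM' : DirectSum.IsInternal fun pq : ↥(Finset.antidiagonal k) ↦ hodgePQ E' M' k pq.1.1 pq.1.2) :
    DirectSum.IsInternal fun pq : ↥(Finset.antidiagonal k) ↦ hodgePQ E M k pq.1.1 pq.1.2 := by
  set e := complexDeRhamCohomologyEquivOfInverse hf hg hgf hfg k with he
  have hfun : (fun pq : ↥(Finset.antidiagonal k) ↦ hodgePQ E M k pq.1.1 pq.1.2) =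
      Submodule.orderIsoMapComap e ∘
        fun pq : ↥(Finset.antidiagonal k) ↦ hodgePQ E' M' k pq.1.1 pq.1.2 := by
    funext pq
    rw [Function.comp_apply, Submodule.orderIsoMapComap_apply]
    change hodgePQ E M k pq.1.1 pq.1.2 =
      (hodgePQ E' M' k pq.1.1 pq.1.2).map (complexDeRhamCohomology.map E hf k)
    exact (hodgePQ_map_eq_of_leftInverse hf hf' hg hg' hgf k _ _).symm
  rw [DirectSum.isInternal_submodule_iff_iSupIndep_and_iSup_eq_top] at hM' ⊢
  refine ⟨?_, ?_⟩
  · rw [hfun, iSupIndep_map_orderIso_iff]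
    exact hM'.1
  · rw [hfun]
    change ⨆ pq : ↥(Finset.antidiagonal k),
      Submodule.orderIsoMapComap e (hodgePQ E' M' k pq.1.1 pq.1.2) = ⊤
    rw [← OrderIso.map_iSup, hM'.2, OrderIso.map_top]

end Transport

/-! ### The Hodge decomposition of the standard analytification -/

section StdModel

variable {n : ℕ} {X : Motives.SchemeOver ℂ}

/-- The biholomorphism `X^an_std → A.carrier` over `X(ℂ)` from the standard analytification to
the carrier of any Hodge model `A` (`= ψ_A⁻¹ ∘ φ_std`). [cite: SerreGAGA1956, §2 (fonctorialité)] -/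
def StdCarrier.toHodgeModel (S : StdCarrier n X) (A : HodgeModel n X) : S.carrier → A.carrier :=
  fun s ↦ A.isAnalytification.homeomorph.symm (S.toComplexPoints s)

/-- Its inverse `A.carrier → X^an_std` (`= φ_std⁻¹ ∘ ψ_A`). [cite: SerreGAGA1956, §2 (fonctorialité)] -/
def StdCarrier.ofHodgeModel (S : StdCarrier n X) (A : HodgeModel n X) : A.carrier → S.carrier :=
  fun a ↦ S.isAnalytification.homeomorph.symm (A.toComplexPoints a)

/-- The comparison map `S.toHodgeModel A` lies over `X(ℂ)`. [folklore] -/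
theorem StdCarrier.toComplexPoints_toHodgeModel (S : StdCarrier n X) (A : HodgeModel n X)
    (s : S.carrier) : A.toComplexPoints (S.toHodgeModel A s) = S.toComplexPoints s := by
  change (A.isAnalytification.homeomorph) (A.isAnalytification.homeomorph.symm _) = _
  rw [Homeomorph.apply_symm_apply]

/-- The comparison map `S.ofHodgeModel A` lies over `X(ℂ)`. [folklore] -/
theorem StdCarrier.toComplexPoints_ofHodgeModel (S : StdCarrier n X) (A : HodgeModel n X)
    (a : A.carrier) : S.toComplexPoints (S.ofHodgeModel A a) = A.toComplexPoints a := by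
  change (S.isAnalytification.homeomorph) (S.isAnalytification.homeomorph.symm _) = _
  rw [Homeomorph.apply_symm_apply]

/-- `S.ofHodgeModel A` is a left inverse of `S.toHodgeModel A`. [folklore] -/
theorem StdCarrier.ofHodgeModel_toHodgeModel (S : StdCarrier n X) (A : HodgeModel n X) :
    Function.LeftInverse (S.ofHodgeModel A) (S.toHodgeModel A) := by
  intro s
  apply S.isAnalytification.homeomorph.injective
  rw [IsAnalytification.coe_homeomorph, S.toComplexPoints_ofHodgeModel,
    S.toComplexPoints_toHodgeModel]

/-- `S.ofHodgeModel A` is a right inverse of `S.toHodgeModel A`. [folklore] -/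
theorem StdCarrier.toHodgeModel_ofHodgeModel (S : StdCarrier n X) (A : HodgeModel n X) :
    Function.RightInverse (S.ofHodgeModel A) (S.toHodgeModel A) := by
  intro a
  apply A.isAnalytification.homeomorph.injective
  rw [IsAnalytification.coe_homeomorph, S.toComplexPoints_toHodgeModel,
    S.toComplexPoints_ofHodgeModel]

/-- `X^an_std → A.carrier` is holomorphic (uniqueness of the analytification: GAGA §2
fonctorialité applied to `𝟙 X`). [cite: SerreGAGA1956, §2 (fonctorialité)] -/
theorem StdCarrier.mdifferentiable_toHodgeModel (hX : Motives.IsSmoothProjective n X)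
    (S : StdCarrier n X) (A : HodgeModel n X) :
    MDifferentiable 𝓘(ℂ, Fin n → ℂ) 𝓘(ℂ, A.model) (S.toHodgeModel A) := by
  haveI : AlgebraicGeometry.IsProper X.hom := Motives.IsSmoothProjective.isProper_holds hX
  haveI : AlgebraicGeometry.SmoothOfRelativeDimension n X.hom := hX.smoothOfRelativeDimension
  refine IsAnalytification.mdifferentiable_comp_map_holds S.isAnalytification A.isAnalytification
    (𝟙 X) (S.toHodgeModel A) (funext fun s ↦ ?_)
  rw [Function.comp_apply, Function.comp_apply, S.toComplexPoints_toHodgeModel,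
    Motives.AlgPoints.map_id, id]

/-- `A.carrier → X^an_std` is holomorphic. [cite: SerreGAGA1956, §2 (fonctorialité)] -/
theorem StdCarrier.mdifferentiable_ofHodgeModel (hX : Motives.IsSmoothProjective n X)
    (S : StdCarrier n X) (A : HodgeModel n X) :
    MDifferentiable 𝓘(ℂ, A.model) 𝓘(ℂ, Fin n → ℂ) (S.ofHodgeModel A) := by
  haveI : AlgebraicGeometry.IsProper X.hom := Motives.IsSmoothProjective.isProper_holds hX
  haveI : AlgebraicGeometry.SmoothOfRelativeDimension n X.hom := hX.smoothOfRelativeDimension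
  refine IsAnalytification.mdifferentiable_comp_map_holds A.isAnalytification S.isAnalytification
    (𝟙 X) (S.ofHodgeModel A) (funext fun a ↦ ?_)
  rw [Function.comp_apply, Function.comp_apply, S.toComplexPoints_ofHodgeModel,
    Motives.AlgPoints.map_id, id]

/-- **The Hodge decomposition of the standard analytification** `X^an_std` of a smooth projective
`X/ℂ` (`H^k_dR(X^an; ℂ) = ⨁_{p+q=k} H^{p,q}`, Voisin I Thm. 6.18), obtained from the Hodge model
supplied by `hHD : exists_isReal_hodgeModel` by transport along the biholomorphism
`X^an_std ≅ X^an` over `X(ℂ)`. [cite: VoisinHodgeI2002, Thm. 6.18 and §7.3.2] -/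
theorem isInternal_hodgePQ_stdCarrier (hHD : exists_isReal_hodgeModel)
    (hX : Motives.IsSmoothProjective n X) (k : ℕ) :
    DirectSum.IsInternal fun pq : ↥(Finset.antidiagonal k) ↦
      hodgePQ (Fin n → ℂ) (stdCarrier hX).carrier k pq.1.1 pq.1.2 := by
  set S := stdCarrier hX
  set A := BettiUniverse.realHodgeModel hHD hX
  haveI : CompleteSpace A.model := FiniteDimensional.complete ℂ A.model
  haveI : CompleteSpace (Fin n → ℂ) := FiniteDimensional.complete ℂ (Fin n → ℂ)
  have hf' := S.mdifferentiable_toHodgeModel hX A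
  have hg' := S.mdifferentiable_ofHodgeModel hX A
  exact isInternal_hodgePQ_transport hf'.contMDiff_real_of_complex hf' hg'.contMDiff_real_of_complex
    hg' (S.ofHodgeModel_toHodgeModel A) (S.toHodgeModel_ofHodgeModel A) (A.isInternal_hodgePQ k)

/-- **The standard Hodge model of a smooth projective `X/ℂ`**: the standard analytification
`X^an` charted on `ℂⁿ`, with the complexified standard de Rham family `(stdFamily n) ⊗ ℂ`
(natural, `DeRhamIsoFamily.complexify_isNatural`) and the Hodge decomposition of
`isInternal_hodgePQ_stdCarrier`. An `abbrev`: `(stdModel hHD hX).model` is `Fin n → ℂ` and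
`(stdModel hHD hX).carrier` is `(stdCarrier hX).carrier` by `rfl`, reducibly.
[cite: SerreGAGA1956, §2] [cite: VoisinHodgeI2002, §4.3.2 Rem. 4.48 and Thm. 6.18]
[cite: WarnerGTM94, Thm. 5.36] -/
abbrev stdModel (hHD : exists_isReal_hodgeModel) (hX : Motives.IsSmoothProjective n X) :
    HodgeModel n X where
  model := Fin n → ℂ
  carrier := (stdCarrier hX).carrier
  isManifold_real := (stdCarrier hX).isManifold_real
  sigmaCompactSpace := (stdCarrier hX).sigmaCompactSpace
  toComplexPoints := (stdCarrier hX).toComplexPoints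
  isAnalytification := (stdCarrier hX).isAnalytification
  deRham := (stdFamily n).complexify
  deRham_isNatural := DeRhamIsoFamily.complexify_isNatural (stdFamily_isNatural n)
  isInternal_hodgePQ := isInternal_hodgePQ_stdCarrier hHD hX

/-- The model space of the standard Hodge model is literally `Fin n → ℂ`. [folklore] -/
theorem stdModel_model (hHD : exists_isReal_hodgeModel) (hX : Motives.IsSmoothProjective n X) :
    (stdModel hHD hX).model = (Fin n → ℂ) := rfl

/-- The carrier of the standard Hodge model is the chosen standard carrier. [folklore] -/
theorem stdModel_carrier (hHD : exists_isReal_hodgeModel) (hX : Motives.IsSmoothProjective n X) :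
    (stdModel hHD hX).carrier = (stdCarrier hX).carrier := rfl

/-- The structure map of the standard Hodge model is that of the standard carrier. [folklore] -/
theorem stdModel_toComplexPoints (hHD : exists_isReal_hodgeModel)
    (hX : Motives.IsSmoothProjective n X) :
    (stdModel hHD hX).toComplexPoints = (stdCarrier hX).toComplexPoints := rfl

/-- The comparison of the standard model at any `ℂⁿ`-charted manifold is `(stdFamily n) ⊗ ℂ`,
i.e. `complexifyFun (stdFamily n)`. [cite: VoisinHodgeI2002, §4.3.2 Rem. 4.48] -/
theorem stdModel_deRham_apply (hHD : exists_isReal_hodgeModel)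
    (hX : Motives.IsSmoothProjective n X) (M : Type) [TopologicalSpace M]
    [ChartedSpace (Fin n → ℂ) M] [IsManifold 𝓘(ℝ, Fin n → ℂ) ∞ M] [T2Space M]
    [SigmaCompactSpace M] (k : ℕ) (c : complexDeRhamCohomology (Fin n → ℂ) M k) :
    (stdModel hHD hX).deRham M k c = complexifyFun (stdFamily n) k c :=
  rfl

end StdModel

end Literature.AlgebraicGeometry.HodgeTheory

end
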